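import Summits.NavierStokesRegularity.FluidComputer.PalasekTowerRegisterGlobalLetterWitness
import Summits.NavierStokesRegularity.NavierStokesRegularity.Theses.PalasekTowerBreakdown

/-!
# `PalasekTowerBreakdown.HeredityFromTwo`: the readout LETTER the crux asks for pins no energy

Cell `ns-blowup`, seat `ns-blowup-ecbridge-5` (g4); helper file for the child crux
stmt-NavierStokesRegularity-19250 `HeredityFromTwo` (stubs `stub_continuation_envelope` /
`stub_readout_floors`) and its parent -19178 `EpisodeInduction`, reading the register files
`FluidComputer/PalasekTowerRegisterGlobalLetterField.lean` (p440124) /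
`…LetterWitness.lean` BY NAME on the route decls. LABEL: E–C typing (kinematics + one
kernel equivalence). WHAT THIS IS NOT: not Navier–Stokes evidence — nothing here constructs a
stage, a continuation or a tower, and the crux is used only as a hypothesis or restated as an
equivalence; the witness field is a time-slice, not a flow.

* `palasekTowerBreakdown_heredityFromTwo_iff_runs_letter`: the child crux IS «every registered
  stage at level `k ≥ 2` has a continuation that RUNS (classical, agreeing on `[0, τ k]`, finite
  energy, inside the ceiling `c₂ Y_{k+1}`) and whose slice at `τ (k+1)` is a level-`(k+1)` LETTER»
  (the fc-oneshot gate vocabulary `Runs` / `Letter`, p422042; per stage this is the tree's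
  `Stage.exists_extends_iff_runs_letter`).
* `palasekTowerBreakdown_letter_witness_of_stage`: next to ANY registered stage at level `k ≥ 1`
  of a rigid schedule whose ball has radius `≥ 1/N_{k+1}`, the level-`(k+1)` letter — the exact
  conclusion `ReadoutFloors` asks of the continuation at `τ (k+1)` — is ALREADY carried by a smooth
  divergence-free field confined to the ball, inside the level-`(k+1)` ceiling, of energy `< 0.22`
  (`π N_{k+1}^{-2/5}`; the stage is not used beyond fixing the schedule: the letter is kinematic).
* `palasekTowerBreakdown_heredityFromTwo_two_letters` / `…_episodeInduction_two_letters`: under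
  the child crux (resp. the parent), at every hand-over `k → k+1` TWO fields meet the same
  level-`(k+1)` letter inside the same ceiling — the extension stage's own readout `s'.u (τ (k+1))`
  (dynamics) and the kinematic witness (energy `< 0.22`): the letter the crux demands carries no
  energy floor, so «energy cannot fund the floors» (item -19250, why-it-might-fail) is not where the
  lower stub can fail; its content is transport / compaction.

References: S. Palasek, arXiv:2605.13827 §3.1, §4 [cite: Palasek2026ElementaryModel, §4];
A. J. Majda, A. L. Bertozzi, *Vorticity and Incompressible Flow* (CUP 2002) §1.2
[cite: MajdaBertozziCUP2002, §1.2].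
-/

noncomputable section

set_option linter.dupNamespace false

namespace Summit.NavierStokesRegularity.NavierStokesRegularity.Theorems

open Set MeasureTheory Filter Topology Function Real
open scoped ENNReal ContDiff NNReal
open Literature.Analysis.FluidPDE
open Summit.NavierStokesRegularity.FluidComputer.PalasekTowerClayBridge

/-- **The child crux through the gate, by name**: `HeredityFromTwo` ⇔ every globally anchored
registered stage at level `k ≥ 2` of a pinned rigid quiet schedule has a continuation that `Runs`
and carries the level-`(k+1)` `Letter` at `τ (k+1)` (per stage: `Stage.exists_extends_iff_runs_letter`).
[cite: Palasek2026ElementaryModel, §4] -/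
theorem palasekTowerBreakdown_heredityFromTwo_iff_runs_letter :
    Theses.PalasekTowerBreakdown.HeredityFromTwo ↔
      ∀ S : Schedule TowerRates.wide, S.Pins 8 (6 / 5) → S.Rigid → S.Quiet → ∀ k : ℕ, 2 ≤ k →
        ∀ s : Stage 1 TowerRates.wide S (Margins.routeG TowerRates.wide) k,
          ∃ (u : ℝ → EuclideanSpace ℝ (Fin 3) → EuclideanSpace ℝ (Fin 3))
            (p : ℝ → EuclideanSpace ℝ (Fin 3) → ℝ),
            Runs S k s u p ∧ Letter S (k + 1) (u (S.τ (k + 1))) :=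
  ⟨fun h S hP hR hQ k hk s => s.exists_extends_iff_runs_letter.1 (h S hP hR hQ k hk s),
    fun h S hP hR hQ k hk s => s.exists_extends_iff_runs_letter.2 (h S hP hR hQ k hk s)⟩

/-- **The letter is already there, kinematically, next to every registered stage.** For a rigid
schedule on the wide rates whose ball has radius `≥ 1/N_{k+1}`, `k ≥ 1`, and ANY registered stage at
level `k` (used only to fix the schedule), there is a `C^∞` divergence-free field confined to the
ball, inside the level-`(k+1)` ceiling `c₂ Y_{k+1}`, meeting the level-`(k+1)` letter
`Letter S (k+1)` — the exact conclusion `ReadoutFloors` asks of the continuation at `τ (k+1)` —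
with energy `∫ ‖v‖² ≤ π N_{k+1}^{-2/5} < 0.22`. [cite: Palasek2026ElementaryModel, §3.1] -/
theorem palasekTowerBreakdown_letter_witness_of_stage {S : Schedule TowerRates.wide} {k : ℕ}
    (hk : 1 ≤ k) (s : Stage 1 TowerRates.wide S (Margins.routeG TowerRates.wide) k)
    (hrad : 1 / TowerRates.wide.N (k + 1) ≤ S.radius) :
    ∃ v : EuclideanSpace ℝ (Fin 3) → EuclideanSpace ℝ (Fin 3),
      ContDiff ℝ ∞ v ∧ VectorCalculus.IsDivFree v ∧
      (∀ y, S.radius < ‖y‖ → v y = 0) ∧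
      (∀ y, ‖v y‖ ≤ S.c₂ * TowerRates.wide.Y (k + 1)) ∧
      Letter S (k + 1) v ∧
      ∫⁻ y, ‖v y‖ₑ ^ 2 ≤ ENNReal.ofReal (22 / 100) := by
  have hc : ‖(0 : EuclideanSpace ℝ (Fin 3))‖ + 1 / TowerRates.wide.N (k + 1) ≤ S.radius := by
    simpa using hrad
  obtain ⟨v, hsm, hdiv, hsupp, hceil, hletter, hE⟩ := exists_letter_of_rigid s.routeG_rigid (k + 1) hc
  refine ⟨v, hsm, hdiv, hsupp, hceil, hletter, hE.trans (ENNReal.ofReal_le_ofReal ?_)⟩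
  have h := wide_letter_energy_lt (m := k + 1) (by omega)
  norm_num at h ⊢
  exact h.le

/-- **Under the child crux, two letters at every hand-over `k → k+1`, `k ≥ 2`**: the extension
stage's own readout `s'.u (τ (k+1))` (the dynamical letter the crux delivers) and a kinematic
witness confined to the ball, inside the same ceiling `c₂ Y_{k+1}`, of energy `< 0.22` — the
letter demanded by `HeredityFromTwo` carries no energy floor. [cite: Palasek2026ElementaryModel, §4] -/
theorem palasekTowerBreakdown_heredityFromTwo_two_letters
    (h : Theses.PalasekTowerBreakdown.HeredityFromTwo)
    {S : Schedule TowerRates.wide} (hP : S.Pins 8 (6 / 5)) (hR : S.Rigid) (hQ : S.Quiet)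
    {k : ℕ} (hk : 2 ≤ k) (s : Stage 1 TowerRates.wide S (Margins.routeG TowerRates.wide) k)
    (hrad : 1 / TowerRates.wide.N (k + 1) ≤ S.radius) :
    ∃ (s' : Stage 1 TowerRates.wide S (Margins.routeG TowerRates.wide) (k + 1))
      (v : EuclideanSpace ℝ (Fin 3) → EuclideanSpace ℝ (Fin 3)),
      s.Extends s' ∧ Letter S (k + 1) (s'.u (S.τ (k + 1))) ∧
      (∀ t ∈ Icc 0 (S.τ (k + 1)), ∀ y, ‖s'.u t y‖ ≤ S.c₂ * TowerRates.wide.Y (k + 1)) ∧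
      ContDiff ℝ ∞ v ∧ VectorCalculus.IsDivFree v ∧ (∀ y, S.radius < ‖y‖ → v y = 0) ∧
      (∀ y, ‖v y‖ ≤ S.c₂ * TowerRates.wide.Y (k + 1)) ∧ Letter S (k + 1) v ∧
      ∫⁻ y, ‖v y‖ₑ ^ 2 ≤ ENNReal.ofReal (22 / 100) := by
  obtain ⟨s', hs'⟩ := h S hP hR hQ k hk s
  obtain ⟨v, hsm, hdiv, hsupp, hceil, hletter, hE⟩ :=
    palasekTowerBreakdown_letter_witness_of_stage (by omega) s hrad
  exact ⟨s', v, hs', Letter.of_stage s' le_rfl, fun t ht y => s'.ceiling (k + 1) le_rfl t ht y,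
    hsm, hdiv, hsupp, hceil, hletter, hE⟩

/-- **The same under the parent crux `EpisodeInduction`, every hand-over `k ≥ 1`** (including the
first rung `1 → 2`). [cite: Palasek2026ElementaryModel, §4] -/
theorem palasekTowerBreakdown_episodeInduction_two_letters
    (h : Theses.PalasekTowerBreakdown.EpisodeInduction)
    {S : Schedule TowerRates.wide} (hP : S.Pins 8 (6 / 5)) (hR : S.Rigid) (hQ : S.Quiet)
    {k : ℕ} (hk : 1 ≤ k) (s : Stage 1 TowerRates.wide S (Margins.routeG TowerRates.wide) k)
    (hrad : 1 / TowerRates.wide.N (k + 1) ≤ S.radius) :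
    ∃ (s' : Stage 1 TowerRates.wide S (Margins.routeG TowerRates.wide) (k + 1))
      (v : EuclideanSpace ℝ (Fin 3) → EuclideanSpace ℝ (Fin 3)),
      s.Extends s' ∧ Letter S (k + 1) (s'.u (S.τ (k + 1))) ∧
      (∀ t ∈ Icc 0 (S.τ (k + 1)), ∀ y, ‖s'.u t y‖ ≤ S.c₂ * TowerRates.wide.Y (k + 1)) ∧
      ContDiff ℝ ∞ v ∧ VectorCalculus.IsDivFree v ∧ (∀ y, S.radius < ‖y‖ → v y = 0) ∧
      (∀ y, ‖v y‖ ≤ S.c₂ * TowerRates.wide.Y (k + 1)) ∧ Letter S (k + 1) v ∧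
      ∫⁻ y, ‖v y‖ₑ ^ 2 ≤ ENNReal.ofReal (22 / 100) := by
  obtain ⟨s', hs'⟩ := h S hP hR hQ k hk s
  obtain ⟨v, hsm, hdiv, hsupp, hceil, hletter, hE⟩ :=
    palasekTowerBreakdown_letter_witness_of_stage hk s hrad
  exact ⟨s', v, hs', Letter.of_stage s' le_rfl, fun t ht y => s'.ceiling (k + 1) le_rfl t ht y,
    hsm, hdiv, hsupp, hceil, hletter, hE⟩

end Summit.NavierStokesRegularity.NavierStokesRegularity.Theorems

end
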